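/-
Copyright: statement-level skeleton of a published paper (lit-balaban cell, Phase-2 proof seat p19, gen 3). No claims beyond
what the kernel checks below.
-/
import Mathlib
import Literature.MathematicalPhysics.QuantumFieldTheory.Balaban1983to89.B3Prop21Model
import Literature.MathematicalPhysics.QuantumFieldTheory.Balaban1983to89.B3Prop1

/-!
# B3 — T. Bałaban, *(Higgs)₂,₃ quantum fields in a finite volume. III. Renormalization*, CMP **88** (1983) 411–445
[Balaban1983Higgs3] — Proposition 2.1 p. 424: r15's typed statement `B3Prop1.Prop21` INHABITED for the family of localized
lattice graph amplitudes over a count datum (MODEL INSTANCE of row B3.Prop2.1, in the generality of Proposition 2.2)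

statement-level skeleton of published theorems with citation tags; proofs where landed; nothing here is a claim about
the Yang–Mills mass gap

PDF held: `paper:balaban1983-higgs-2-3-quantum-fields-finite-volume` (journal page = PDF page + 410); displays read on
the ×2 renders `pub-balaban/b2b-balaban-ref1/pages/1983-cmp88-higgs23-III/1983-cmp88-higgs23-III-p010, p014 … p018-x2.png`
(pp. 420, 424–428).

Companion of the Phase-2 proof of SKELETON row **B3.Eq2.13-2.14** (unit `lit-balaban-p19` gen 3) and of `B3Prop21Model`
(`Amp.bound133_total`: (2.6) + (2.7) + (2.13) + (2.15) ⇒ (1.33) for the total amplitude), knitting them to r15's typed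
Proposition 2.1 (`B3Prop1.Prop21`, p238938; row B3.Prop2.1, also the shape of row B3.Prop2.2 = `B3Prop1.Prop22`).

WHAT IS REPRODUCED.  Proposition 2.1 p. 424 [PDF 14], verbatim: *"Let G be a connected graph such that its each connected
subgraph, with the possible exception of the subgraphs (2.4), has a positive degree. Then we define G_ren = {G} and
Proposition 1 holds in this case."* (Proposition 1 = (1.33) p. 420 with *"positive constants δ₀, O(1)"*, δ₀ *"depends on the
dimension d only"*, O(1) *"independent of ε, k, the domains Ω, Ω₁, Ω₂, the vector field B̃"*), together with Proposition 2.2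
p. 428: *"Proposition 2.1 holds for the described above generalized expressions and graphs"* (*"The only thing which matters
is that propagators have representations corresponding to (2.6) with the estimates corresponding to (2.10)–(2.12)"*).
KERNEL-CHECKED HERE: r15's `B3Prop1.Prop21 fam` — *"∃ δ₀ > 0, ∀ α₀ ∈ (0,1), ∀ n̄, ∃ O(1) > 0, ∀ datum i, ∀ graph G with
`PosSubgraphsExcept24`, (1.33) for the class {G}, for all localizations and external fields"* — HOLDS (`prop21_amplitudes`)
for the FAMILY `fam n̄ A = expansionOf G Cmax A` of `B3Prop1.GraphExpansion`s attached to the localized lattice graph amplitudes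
`A : Amp G.toModel` (`B3Ineq213Amplitude`) over ONE count datum `G` (`B3Ineq215.Counts`: the graph with its legs,
differentiations, averaged legs, η-powers, `d`, `L`, `δ₁`) whose kernel constants are bounded by `Cmax` and whose running
couplings are positive (index type `Idx G Cmax`; the datum ranges over `k`, the vertex functions, the kernels, the
couplings and the norms — the model's rendering of *"independent of ε, k, the domains, the vector field B̃"*): `E({G}, {□(v)},
Φ, A) := the total amplitude `Amp.Etot` with the unit cubes `{□(v)}` as the localization argument, `d({□(v)})` := the tree
length `boxTreeLen`, `‖hΦ_ext‖ := Π_v N^Φ_v`, `‖h′A_ext‖ := Π_v N^A_v`, `d_v`, `d_s` := the sums of the vertex orders, the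
connected subgraphs `Sub` := the connected components of the subgraphs `G_1 ⊂ … ⊂ G_m` along every ordering l̃ (p. 425) with
their degrees (2.2) (`subDeg` := `degQ`, the ℚ-valued degree, `cast_degQ`), `Is24 := False` (no exceptional subgraphs: the
(2.8)–(2.9) preparation is not modelled); witnesses `δ₀ := ½δ₁` and `O(1) := max 1 (Cmax^m · Σ_{l̃} const215(G along l̃))`
(before the datum, as printed), via `Amp.bound133_total`.  HONEST SCOPE: a model instance — the analytic inputs (2.5),
(2.10)–(2.12) are hypotheses of the class `Amp` (not derived from Propositions I.2.1/I.2.3), the subgraph family is the one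
the printed proof actually uses (components of the `G_i`, every ordering) rather than all connected subgraphs, and the
dependence *"O(1) depends on n̄ only"* is rendered as "O(1) depends on the count datum and `Cmax` only".
-/

open Finset

namespace Literature.MathematicalPhysics.QuantumFieldTheory.Balaban1983to89.B3Ineq213

open B3Ineq215 B3Sect2FirstEstimate B3Prop1

variable {V : Type} [Fintype V] [DecidableEq V] {m : ℕ}

/-! ## The degrees (2.2) of the components, ℚ-valued (r15's `GraphExpansion.subDeg` is ℚ-valued) -/

/-- The exponent of `L^{j_l}η` contributed by the vertex `v` to the line `l`, in ℚ (cf. `Counts.legExp`).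
[cite: Balaban1983Higgs3, (2.14) p.427] -/
def legExpQ (G : Counts V m) (v : V) (l : Fin m) : ℚ :=
  -(((G.d : ℚ) - 2) / 2) * (G.legsOn v l : ℚ) - (G.diffOn v l : ℚ) + (G.vecLegAvg v l : ℚ)

/-- The line dimension `a_l` in ℚ (cf. `Counts.lineDim`). [cite: Balaban1983Higgs3, (2.14) p.427] -/
def lineDimQ (G : Counts V m) (l : Fin m) : ℚ := ∑ v, legExpQ G v l

/-- **(2.2)** p. 423 for the component of `G_i` represented by `b`, in ℚ: `D = Σ_{v ∈ block}(d + e_v) − d + Σ_{lines of the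
block} a_l` (cf. the ℝ-valued `B3Ineq215.Model.D`). [cite: Balaban1983Higgs3, (2.2) p.423] -/
noncomputable def degQ (G : Counts V m) (i : ℕ) (b : V) : ℚ :=
  (∑ v ∈ G.toModel.fiber i b, ((G.d : ℚ) + (G.etaPow v : ℚ))) - G.d + ∑ l ∈ G.toModel.before i b, lineDimQ G l

/-- `legExpQ` casts to `Counts.legExp`. [cite: Balaban1983Higgs3, (2.14) p.427] -/
theorem cast_legExpQ (G : Counts V m) (v : V) (l : Fin m) : ((legExpQ G v l : ℚ) : ℝ) = G.legExp v l := by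
  unfold legExpQ Counts.legExp
  push_cast
  ring

/-- `lineDimQ` casts to `Counts.lineDim`. [cite: Balaban1983Higgs3, (2.14) p.427] -/
theorem cast_lineDimQ (G : Counts V m) (l : Fin m) : ((lineDimQ G l : ℚ) : ℝ) = G.lineDim l := by
  unfold lineDimQ Counts.lineDim
  push_cast
  exact sum_congr rfl fun v _ => cast_legExpQ G v l

/-- `degQ` casts to the ℝ-valued degree `Model.D` of the gen-2 files. [cite: Balaban1983Higgs3, (2.2) p.423] -/
theorem cast_degQ (G : Counts V m) (i : ℕ) (b : V) : ((degQ G i b : ℚ) : ℝ) = G.toModel.D i b := by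
  unfold degQ Model.D
  push_cast
  have ha : ∀ l, ((lineDimQ G l : ℚ) : ℝ) = G.toModel.a l := fun l => cast_lineDimQ G l
  have he : ∀ v, ((G.etaPow v : ℕ) : ℝ) = G.toModel.e v := fun v => rfl
  have hd : ((G.d : ℕ) : ℝ) = (G.toModel.d : ℝ) := rfl
  simp only [ha, he, hd]

/-! ## The family of graph expansions attached to the amplitudes over a count datum -/

namespace Amp

variable {G : Counts V m} (A : Amp G.toModel)

/-- The amplitude with the unit cubes `{□(v)}` replaced (the localization is an ARGUMENT of `E(G, {□(v)}, Φ, A)` in (1.33)).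
[cite: Balaban1983Higgs3, (1.33) p.420] -/
noncomputable def withBox (box : V → Fin G.toModel.d → ℕ) : Amp G.toModel :=
  { A with box := box }

/-- `withBox` changes only the cubes: `k` is kept. [cite: Balaban1983Higgs3, (1.33) p.420] -/
@[simp] theorem withBox_k (box : V → Fin G.toModel.d → ℕ) : (A.withBox box).k = A.k := rfl

/-- `withBox` sets the cubes. [cite: Balaban1983Higgs3, (1.33) p.420] -/
@[simp] theorem withBox_box (box : V → Fin G.toModel.d → ℕ) : (A.withBox box).box = box := rfl

end Amp

/-- The index type of the family: the localized lattice graph amplitudes over the count datum `G` whose kernel constants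
`C_l` (the O(1) of (2.10)–(2.12)) are bounded by `Cmax` and whose running couplings are positive (r15's `Expansion` requires
`0 < e(L^kε)`, `0 < λ(L^kε)`). [cite: Balaban1983Higgs3, Prop. 2.1 p.424] -/
def Idx (G : Counts V m) (Cmax : ℝ) : Type :=
  {A : Amp G.toModel // (∀ l, A.C l ≤ Cmax) ∧ 0 < A.eRun ∧ 0 < A.lamRun}

/-- The connected subgraphs the printed proof works with: the connected components (non-trivial blocks) of the subgraphs
`G_1 ⊂ … ⊂ G_m` built along an ordering l̃ (p. 425), for every ordering. [cite: Balaban1983Higgs3, Prop. 2.1 p.425] -/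
def Component (G : Counts V m) : Type :=
  Σ σ : Equiv.Perm (Fin m), Σ i : Fin (m + 1),
    {b : V // b ∈ (relabelCounts G σ).toModel.reps i ∧ (relabelCounts G σ).toModel.Nontriv i b}

/-- **The graph expansion of r15's carrier `B3Prop1.GraphExpansion` attached to an amplitude** `A` over the count datum
`G`: one renormalized class `{G}` (`RenClass = Graph = Unit`), localizations = the unit cubes `{□(v)}`, `E({G}, {□(v)}, ·, ·)`
= the total amplitude `Amp.Etot` at those cubes, `d({□(v)})` = `boxTreeLen`, norms = `Π_v N^Φ_v`, `Π_v N^A_v` (the external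
fields are inside the vertex functions of the model, so `ExtS = ExtV = Unit`), orders `d_v(G) = Σ_v d_v(v)`, `d_s(G) =
Σ_v d_s(v)`, connected subgraphs = `Component G` with degrees `degQ`, no exceptional subgraphs (2.4).
[cite: Balaban1983Higgs3, Prop. 2.1 p.424] -/
noncomputable def expansionOf (G : Counts V m) (A : Amp G.toModel) (he : 0 < A.eRun) (hl : 0 < A.lamRun) :
    GraphExpansion where
  eRun := A.eRun
  lamRun := A.lamRun
  eRun_pos := he
  lamRun_pos := hl
  RenClass := Unit
  Loc := fun _ => V → Fin G.toModel.d → ℕ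
  ExtS := Unit
  ExtV := Unit
  E := fun _ box _ _ => (A.withBox box).Etot
  ds := fun _ => ∑ v, A.ds v
  dv := fun _ => ∑ v, A.dv v
  treeLen := fun _ box => boxTreeLen G.L A.k box
  treeLen_nonneg := fun _ box => boxTreeLen_nonneg G.L A.k box
  normS := fun _ _ _ _ => ∏ v, A.NPhi v
  normV := fun _ _ _ _ => ∏ v, A.NA v
  normS_nonneg := fun _ _ _ _ => prod_nonneg fun v _ => A.NPhi_nonneg v
  normV_nonneg := fun _ _ _ _ => prod_nonneg fun v _ => A.NA_nonneg v
  Graph := Unit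
  single := fun _ => ()
  Connected := fun _ => True
  Sub := fun _ => Component G
  subDeg := fun _ H => degQ (relabelCounts G H.1) H.2.1 H.2.2.1
  Is24 := fun _ _ => False

/-- The family `fam n̄ i` of r15's `Prop21`: constant in `n̄`, indexed by the amplitudes `Idx G Cmax`.
[cite: Balaban1983Higgs3, Prop. 2.1 p.424] -/
noncomputable def famOf (G : Counts V m) (Cmax : ℝ) : ℕ → Idx G Cmax → GraphExpansion :=
  fun _ A => expansionOf G A.1 A.2.2.1 A.2.2.2

/-- The printed hypothesis, read on the model: `PosSubgraphsExcept24` for the expansion of an amplitude says that every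
component of every `G_i` along every ordering has positive (ℝ-valued) degree — the hypothesis of `Amp.bound133_total`.
[cite: Balaban1983Higgs3, Prop. 2.1 p.424] -/
theorem hpos_of_posSubgraphs {G : Counts V m} {A : Amp G.toModel} {he : 0 < A.eRun} {hl : 0 < A.lamRun}
    (h : PosSubgraphsExcept24 (expansionOf G A he hl) ()) (σ : Equiv.Perm (Fin m)) :
    ∀ i, i ≤ m → ∀ b ∈ (relabelCounts G σ).toModel.reps i, (relabelCounts G σ).toModel.Nontriv i b →
      0 < (relabelCounts G σ).toModel.D i b := by
  intro i hi b hb hn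
  have h' := h.2 ⟨σ, ⟨i, Nat.lt_succ_of_le hi⟩, ⟨b, hb, hn⟩⟩
  rcases h' with h0 | hpos
  · exact (h0 : False).elim
  · have hc := cast_degQ (relabelCounts G σ) i b
    have : (0 : ℝ) < ((degQ (relabelCounts G σ) i b : ℚ) : ℝ) := by exact_mod_cast hpos
    rw [hc] at this
    exact this

/-- **Proposition 2.1 for the family of localized lattice graph amplitudes over a count datum — r15's `B3Prop1.Prop21`
INHABITED**: with `δ₀ := ½δ₁` (chosen first) and `O(1) := max 1 (Cmax^m · Σ_{l̃} const215(G along l̃))` (chosen after α₀, n̄ and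
before the datum), (1.33) holds for the class `{G}` of every datum whose components of the `G_i` (all orderings) have positive
degrees, for all unit cubes and all external-field data — by `Amp.bound133_total` ((2.6), (2.7), (2.13), (2.15)).
[cite: Balaban1983Higgs3, Prop. 2.1 p.424] -/
theorem prop21_amplitudes (G : Counts V m) (Cmax : ℝ) : Prop21 (famOf G Cmax) := by
  classical
  refine ⟨G.δ₁ / 2, half_pos G.δ₁_pos, fun α₀ _ _ _ => ?_⟩
  set Csum : ℝ := ∑ σ : Equiv.Perm (Fin m), (relabelCounts G σ).toModel.const215 with hCsum
  refine ⟨max 1 (Cmax ^ m * Csum), lt_max_of_lt_left one_pos, fun A u hG => ?_⟩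
  intro box Φ Aext
  obtain ⟨A, hAC, he, hl⟩ := A
  -- the printed hypothesis gives positive degrees of all components along all orderings
  have hpos := fun σ => hpos_of_posSubgraphs hG σ
  -- (1.33) for the total amplitude at the cubes `box`
  have hmain := (A.withBox box).bound133_total hpos
  -- the constants: Π C_l ≤ Cmax^m and Σ const215 ≥ 0 (each const215 > 0 under the degree hypothesis)
  have hC : ∏ l, (A.withBox box).C l ≤ Cmax ^ m := by
    calc ∏ l, (A.withBox box).C l ≤ ∏ _l : Fin m, Cmax :=
          prod_le_prod (fun l _ => A.C_nonneg l) fun l _ => hAC l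
      _ = Cmax ^ m := by rw [prod_const, card_univ, Fintype.card_fin]
  have hCsum0 : 0 ≤ Csum := by
    rw [hCsum]
    refine sum_nonneg fun σ _ => le_of_lt ((relabelCounts G σ).toModel.const215_pos fun i hi => ?_)
    exact (relabelCounts G σ).toModel.Dsum_succ_pos hi (hpos σ (i + 1) hi)
  have hpref : 0 ≤ (A.withBox box).pref := (A.withBox box).pref_nonneg
  have hK : (∏ l, (A.withBox box).C l) * Csum ≤ max 1 (Cmax ^ m * Csum) :=
    (mul_le_mul_of_nonneg_right hC hCsum0).trans (le_max_right _ _)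
  -- assemble in the shape of `Ineq133At`
  show |(A.withBox box).Etot| ≤ max 1 (Cmax ^ m * Csum) * A.eRun ^ (∑ v, A.dv v) * A.lamRun ^ (∑ v, A.ds v)
      * Real.exp (-(G.δ₁ / 2 * boxTreeLen G.L A.k box)) * (∏ v, A.NPhi v) * (∏ v, A.NA v)
  have e : max 1 (Cmax ^ m * Csum) * A.eRun ^ (∑ v, A.dv v) * A.lamRun ^ (∑ v, A.ds v)
      * Real.exp (-(G.δ₁ / 2 * boxTreeLen G.L A.k box)) * (∏ v, A.NPhi v) * (∏ v, A.NA v)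
      = max 1 (Cmax ^ m * Csum) * (A.withBox box).pref := by
    show _ = max 1 (Cmax ^ m * Csum) * (A.eRun ^ (∑ v, A.dv v) * A.lamRun ^ (∑ v, A.ds v)
      * Real.exp (-(G.δ₁ / 2 * boxTreeLen G.L A.k box)) * (∏ v, A.NPhi v) * ∏ v, A.NA v)
    ring
  rw [e]
  calc |(A.withBox box).Etot| ≤ (∏ l, (A.withBox box).C l) * Csum * (A.withBox box).pref := hmain
    _ ≤ max 1 (Cmax ^ m * Csum) * (A.withBox box).pref := mul_le_mul_of_nonneg_right hK hpref

/-- The same family also inhabits r15's `B3Prop1.Prop22` (Proposition 2.2 has, by r15's typing, the logical shape of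
Proposition 2.1 for generalized expansions; the amplitudes `Amp` ARE in the generality of Proposition 2.2: arbitrary
η-powers `e_v ≥ 0` and line dimensions `a_l`). [cite: Balaban1983Higgs3, Prop. 2.2 p.428] -/
theorem prop22_amplitudes (G : Counts V m) (Cmax : ℝ) : Prop22 (famOf G Cmax) :=
  prop21_amplitudes G Cmax

end Literature.MathematicalPhysics.QuantumFieldTheory.Balaban1983to89.B3Ineq213
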